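import Mathlib.MeasureTheory.Measure.Lebesgue.EqHaar
import Mathlib.MeasureTheory.Measure.Haar.InnerProductSpace
import Mathlib.MeasureTheory.Measure.Haar.NormedSpace
import Mathlib.Analysis.InnerProductSpace.PiL2
import Literature.Analysis.UnboundedOperators.HeatKernelBoundedData
import Literature.Analysis.FunctionSpaces.SobolevDomain
import Literature.Analysis.FluidPDE.RieszKernelBounds

/-!
# Route HardyPointSink — crux `NoHardyTypeIAncient`, line `birth`: Hardy ⇒ `𝔹`

Stub `stub_hardyLargeScale` of the registered skeleton of line `birth` for the crux
`Summit.NavierStokesRegularity.NavierStokesRegularity.Theses.HardyPointSink.NoHardyTypeIAncient`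
(item stmt-NavierStokesRegularity-7980): a bounded measurable slice `g : ℝ³ → ℝ³` whose Hardy
integrals `∫ |g|²/|x − x₀| ≤ K` are bounded about every centre lies in Albritton–Barker's class
`𝔹` (arXiv:1811.00502 §4): (i) `√σ ‖e^{σΔ} g‖_∞ ≤ A` for all `σ > 0` (weighted AM–GM against the
Gauss–Weierstrass kernel, `∫ K_σ(y)²|y| dy ≤ c/σ`, and the Hardy bound about the centre `x`);
(ii) `∫ ⟪λ g(λx), φ(x)⟫ dx → 0` as `λ → ∞` for every test field `φ`
(`|∫ ⟪λ g(λx), φ⟫| ≤ λ⁻² ‖φ‖_∞ ∫_{B_{λR}} |g|` and `ρ⁻² ∫_{B_ρ} |g| → 0` by the Hardy tail off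
`B_R` plus the sup bound on `B_R`). Mathlib plus the tree's heat-kernel API (`HeatKernel`,
`HeatKernelBoundedData`) and the `ℝ³` dilation formula `RieszKernel.lintegral_comp_smul`. [folklore]
-/

open MeasureTheory Set Function Filter TopologicalSpace
open scoped ENNReal NNReal Topology RealInnerProductSpace

set_option linter.dupNamespace false -- nested layout Summit.<S>.<Sub>, Sub = S (D-0017)

namespace Summit.NavierStokesRegularity.NavierStokesRegularity.Theorems

open Literature.Analysis.UnboundedOperators

/-- Local notation for physical space `ℝ³ = EuclideanSpace ℝ (Fin 3)`. -/
local notation "ℝ³" => EuclideanSpace ℝ (Fin 3)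

/-- Weighted AM–GM in `ℝ≥0∞` with the weight `‖y‖` (`y ≠ 0`), form used for the heat-kernel bound:
`|k| ‖v‖ ≤ (λ/2) |k|² ‖y‖ + (1/(2λ)) ‖v‖² / ‖y‖`. [folklore] -/
theorem enorm_mul_enorm_le_weighted {E F : Type*} [NormedAddCommGroup E] [NormedAddCommGroup F]
    (k : ℝ) (v : F) {y : E} (hy : y ≠ 0) {lam : ℝ} (hlam : 0 < lam) :
    ‖k‖ₑ * ‖v‖ₑ ≤ ENNReal.ofReal (lam / 2) * (‖k‖ₑ ^ 2 * ‖y‖ₑ) +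
      ENNReal.ofReal (1 / (2 * lam)) * (‖v‖ₑ ^ 2 / ‖y‖ₑ) := by
  have hr : 0 < ‖y‖ := norm_pos_iff.2 hy
  rw [← ofReal_norm k, ← ofReal_norm v, ← ofReal_norm y, ← ENNReal.ofReal_pow (norm_nonneg _),
    ← ENNReal.ofReal_pow (norm_nonneg _), ← ENNReal.ofReal_mul (norm_nonneg _),
    ← ENNReal.ofReal_mul (sq_nonneg _), ← ENNReal.ofReal_div_of_pos hr,
    ← ENNReal.ofReal_mul (by positivity), ← ENNReal.ofReal_mul (by positivity),
    ← ENNReal.ofReal_add (by positivity) (by positivity)]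
  refine ENNReal.ofReal_le_ofReal ?_
  -- it is `(λ|y| |k| - ‖v‖)² / (2λ|y|) ≥ 0`
  have h1 : lam / 2 * (‖k‖ ^ 2 * ‖y‖) + 1 / (2 * lam) * (‖v‖ ^ 2 / ‖y‖) - ‖k‖ * ‖v‖ =
      (lam * ‖y‖ * ‖k‖ - ‖v‖) ^ 2 / (2 * (lam * ‖y‖)) := by
    field_simp
    ring
  linarith [div_nonneg (sq_nonneg (lam * ‖y‖ * ‖k‖ - ‖v‖))
    (by positivity : (0 : ℝ) ≤ 2 * (lam * ‖y‖))]

/-- Weighted AM–GM in `ℝ≥0∞` with the weight `‖y‖` (`y ≠ 0`), form used for the ball means: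
`‖v‖ ≤ (μ/2) ‖v‖² / ‖y‖ + (1/(2μ)) ‖y‖`. [folklore] -/
theorem enorm_le_weighted {E F : Type*} [NormedAddCommGroup E] [NormedAddCommGroup F]
    (v : F) {y : E} (hy : y ≠ 0) {μ : ℝ} (hμ : 0 < μ) :
    ‖v‖ₑ ≤ ENNReal.ofReal (μ / 2) * (‖v‖ₑ ^ 2 / ‖y‖ₑ) + ENNReal.ofReal (1 / (2 * μ)) * ‖y‖ₑ := by
  have hr : 0 < ‖y‖ := norm_pos_iff.2 hy
  rw [← ofReal_norm v, ← ofReal_norm y, ← ENNReal.ofReal_pow (norm_nonneg _),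
    ← ENNReal.ofReal_div_of_pos hr, ← ENNReal.ofReal_mul (by positivity),
    ← ENNReal.ofReal_mul (by positivity), ← ENNReal.ofReal_add (by positivity) (by positivity)]
  refine ENNReal.ofReal_le_ofReal ?_
  -- it is `(μ‖v‖ - |y|)² / (2μ|y|) ≥ 0`
  have h1 : μ / 2 * (‖v‖ ^ 2 / ‖y‖) + 1 / (2 * μ) * ‖y‖ - ‖v‖ =
      (μ * ‖v‖ - ‖y‖) ^ 2 / (2 * (μ * ‖y‖)) := by
    field_simp
    ring
  linarith [div_nonneg (sq_nonneg (μ * ‖v‖ - ‖y‖)) (by positivity : (0 : ℝ) ≤ 2 * (μ * ‖y‖))]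

/-! ### Part (i): the heat-kernel `Ḃ^{-1}_{∞,∞}` bound from the Hardy bound -/

/-- Kernel bound on `ℝ³`: `∫ K_σ(y)² ‖y‖ dy ≤ (4πσ)^{-3/2} · 2·2^{3/2} σ^{1/2}` (sup of the kernel,
`heatKernel_le`, times its first absolute moment, `integral_heatKernel_mul_norm_le`). [folklore] -/
theorem lintegral_heatKernel_sq_mul_norm_le {σ : ℝ} (hσ : 0 < σ) :
    ∫⁻ y : ℝ³, ‖heatKernel σ y‖ₑ ^ 2 * ‖y‖ₑ ≤
      ENNReal.ofReal ((4 * Real.pi * σ) ^ (-(3 : ℝ) / 2) *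
        (2 * 2 ^ ((3 : ℝ) / 2) * σ ^ (1 / 2 : ℝ))) := by
  have hsup : ∀ y : ℝ³, heatKernel σ y ≤ (4 * Real.pi * σ) ^ (-(3 : ℝ) / 2) := fun y => by
    have h := heatKernel_le hσ y
    rwa [finrank_euclideanSpace_fin, Nat.cast_ofNat] at h
  have hint : Integrable (fun y : ℝ³ => heatKernel σ y * ‖y‖) := integrable_heatKernel_mul_norm hσ
  have hM := integral_heatKernel_mul_norm_le (E := ℝ³) hσ
  rw [finrank_euclideanSpace_fin, Nat.cast_ofNat] at hM
  calc ∫⁻ y : ℝ³, ‖heatKernel σ y‖ₑ ^ 2 * ‖y‖ₑ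
      ≤ ∫⁻ y : ℝ³, ENNReal.ofReal ((4 * Real.pi * σ) ^ (-(3 : ℝ) / 2)) *
          ENNReal.ofReal (heatKernel σ y * ‖y‖) := by
        refine lintegral_mono fun y => ?_
        have hk0 : 0 ≤ heatKernel σ y := (heatKernel_pos hσ y).le
        rw [Real.enorm_eq_ofReal hk0, ← ofReal_norm, ← ENNReal.ofReal_pow hk0,
          ← ENNReal.ofReal_mul (sq_nonneg _), ← ENNReal.ofReal_mul (by positivity)]
        refine ENNReal.ofReal_le_ofReal ?_
        rw [sq, mul_assoc]
        exact mul_le_mul_of_nonneg_right (hsup y) (by positivity)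
    _ = ENNReal.ofReal ((4 * Real.pi * σ) ^ (-(3 : ℝ) / 2)) *
          ENNReal.ofReal (∫ y : ℝ³, heatKernel σ y * ‖y‖) := by
        rw [lintegral_const_mul' _ _ ENNReal.ofReal_ne_top, ofReal_integral_eq_lintegral_ofReal
          hint (ae_of_all _ fun y => mul_nonneg (heatKernel_pos hσ y).le (norm_nonneg _))]
    _ ≤ _ := by
        rw [← ENNReal.ofReal_mul (by positivity)]
        exact ENNReal.ofReal_le_ofReal (mul_le_mul_of_nonneg_left hM (by positivity))

/-- The constant bookkeeping of part (i): with `λ = √σ`,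
`√σ · (λ/2 · (4πσ)^{-3/2} · 2·2^{3/2} σ^{1/2} + K/(2λ)) = (4π)^{-3/2} 2^{3/2} + K/2`. [folklore] -/
theorem hardyHeat_constant {σ : ℝ} (hσ : 0 < σ) (K : ℝ) :
    Real.sqrt σ * (Real.sqrt σ / 2 * ((4 * Real.pi * σ) ^ (-(3 : ℝ) / 2) *
      (2 * 2 ^ ((3 : ℝ) / 2) * σ ^ (1 / 2 : ℝ))) + 1 / (2 * Real.sqrt σ) * K) =
      (4 * Real.pi) ^ (-(3 : ℝ) / 2) * 2 ^ ((3 : ℝ) / 2) + K / 2 := by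
  have h1 : (4 * Real.pi * σ) ^ (-(3 : ℝ) / 2) =
      (4 * Real.pi) ^ (-(3 : ℝ) / 2) * σ ^ (-(3 : ℝ) / 2) := Real.mul_rpow (by positivity) hσ.le
  have h2 : σ ^ (-(3 : ℝ) / 2) * σ ^ (1 / 2 : ℝ) = σ⁻¹ := by
    rw [← Real.rpow_add hσ, ← Real.rpow_neg_one]
    norm_num
  have h3 : Real.sqrt σ * Real.sqrt σ = σ := Real.mul_self_sqrt hσ.le
  have h4 : Real.sqrt σ ≠ 0 := (Real.sqrt_pos.2 hσ).ne'
  rw [h1]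
  calc _ = (Real.sqrt σ * Real.sqrt σ) * (σ ^ (-(3 : ℝ) / 2) * σ ^ (1 / 2 : ℝ)) *
        ((4 * Real.pi) ^ (-(3 : ℝ) / 2) * 2 ^ ((3 : ℝ) / 2)) +
        (Real.sqrt σ / Real.sqrt σ) * (K / 2) := by ring
    _ = _ := by rw [h3, h2, div_self h4, mul_inv_cancel₀ hσ.ne']; ring

/-- **Part (i) of `stub_hardyLargeScale`.** If `∫ |g|²/|x − x₀| ≤ K` for every centre `x₀`, then
`√σ ‖e^{σΔ} g (x)‖ ≤ (4π)^{-3/2} 2^{3/2} + K/2` for all `σ > 0`, `x ∈ ℝ³`: by the weighted AM–GM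
`K_σ(y)|g(x−y)| ≤ (√σ/2) K_σ(y)² |y| + |g(x−y)|²/(2√σ|y|)`, the kernel bound
`∫ K_σ² |y| ≤ c/σ` and the Hardy bound about the centre `x`. [folklore] -/
theorem sqrt_mul_norm_heatExtension_le_of_hardy (g : ℝ³ → ℝ³) (K : ℝ≥0)
    (hH : ∀ x₀ : ℝ³, ∫⁻ x, ‖g x‖ₑ ^ 2 / ‖x - x₀‖ₑ ≤ K) {σ : ℝ} (hσ : 0 < σ) (x : ℝ³) :
    Real.sqrt σ * ‖heatExtension g σ x‖ ≤
      (4 * Real.pi) ^ (-(3 : ℝ) / 2) * 2 ^ ((3 : ℝ) / 2) + K / 2 := by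
  set lam := Real.sqrt σ with hlam_def
  have hlam : 0 < lam := Real.sqrt_pos.2 hσ
  have h1 : ‖heatExtension g σ x‖ₑ ≤ ∫⁻ y, ‖heatKernel σ y‖ₑ * ‖g (x - y)‖ₑ :=
    enorm_convolution_lsmul_le _ _ _
  -- weighted AM–GM, a.e. (off the origin)
  have hae : ∀ᵐ y : ℝ³ ∂volume, y ≠ 0 := by
    filter_upwards [show ({0}ᶜ : Set ℝ³) ∈ ae volume from
      compl_mem_ae_iff.2 (measure_singleton _)] with y hy
    exact hy
  have h2 : ∫⁻ y, ‖heatKernel σ y‖ₑ * ‖g (x - y)‖ₑ ≤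
      ∫⁻ y, (ENNReal.ofReal (lam / 2) * (‖heatKernel σ y‖ₑ ^ 2 * ‖y‖ₑ) +
        ENNReal.ofReal (1 / (2 * lam)) * (‖g (x - y)‖ₑ ^ 2 / ‖y‖ₑ)) :=
    lintegral_mono_ae (hae.mono fun y hy => enorm_mul_enorm_le_weighted _ _ hy hlam)
  have hmeas : Measurable fun y : ℝ³ => ENNReal.ofReal (lam / 2) * (‖heatKernel σ y‖ₑ ^ 2 * ‖y‖ₑ) :=
    (((continuous_heatKernel σ).measurable.enorm.pow_const 2).mul measurable_enorm).const_mul _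
  rw [lintegral_add_left hmeas, lintegral_const_mul' _ _ ENNReal.ofReal_ne_top,
    lintegral_const_mul' _ _ ENNReal.ofReal_ne_top] at h2
  -- the Hardy term, recentred at `x`
  have hB : ∫⁻ y, ‖g (x - y)‖ₑ ^ 2 / ‖y‖ₑ ≤ K := by
    have h := lintegral_sub_left_eq_self (μ := volume) (fun z : ℝ³ => ‖g z‖ₑ ^ 2 / ‖z - x‖ₑ) x
    simp only [sub_sub_cancel_left, enorm_neg] at h
    exact h ▸ hH x
  have hA := lintegral_heatKernel_sq_mul_norm_le hσ
  have htot : ‖heatExtension g σ x‖ₑ ≤ ENNReal.ofReal (lam / 2 * ((4 * Real.pi * σ) ^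
      (-(3 : ℝ) / 2) * (2 * 2 ^ ((3 : ℝ) / 2) * σ ^ (1 / 2 : ℝ))) + 1 / (2 * lam) * K) := by
    refine h1.trans (h2.trans ?_)
    rw [ENNReal.ofReal_add (by positivity) (by positivity), ENNReal.ofReal_mul (by positivity),
      ENNReal.ofReal_mul (by positivity) (q := (K : ℝ)), ENNReal.ofReal_coe_nnreal]
    gcongr
  rw [← ofReal_norm, ENNReal.ofReal_le_ofReal_iff (by positivity)] at htot
  calc lam * ‖heatExtension g σ x‖
      ≤ lam * (lam / 2 * ((4 * Real.pi * σ) ^ (-(3 : ℝ) / 2) *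
          (2 * 2 ^ ((3 : ℝ) / 2) * σ ^ (1 / 2 : ℝ))) + 1 / (2 * lam) * K) :=
        mul_le_mul_of_nonneg_left htot hlam.le
    _ = (4 * Real.pi) ^ (-(3 : ℝ) / 2) * 2 ^ ((3 : ℝ) / 2) + K / 2 := hardyHeat_constant hσ K

/-! ### Part (ii): the Navier–Stokes rescalings `λ g(λ·)` tend to `0` in `𝒟'` -/

/-- Tails of a finite Lebesgue integral on `ℝ³` off the balls `B_n` tend to zero (dominated
convergence for the indicators of `B_nᶜ`). [folklore] -/
theorem tendsto_lintegral_compl_ball_zero {h : ℝ³ → ℝ≥0∞} (hm : AEMeasurable h volume)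
    (hfin : ∫⁻ y, h y ≠ ∞) :
    Tendsto (fun n : ℕ => ∫⁻ y in (Metric.ball (0 : ℝ³) n)ᶜ, h y) atTop (𝓝 0) := by
  have hpt : ∀ y : ℝ³,
      Tendsto (fun n : ℕ => (Metric.ball (0 : ℝ³) n)ᶜ.indicator h y) atTop (𝓝 0) := by
    intro y
    have hev : ∀ᶠ n : ℕ in atTop, (Metric.ball (0 : ℝ³) n)ᶜ.indicator h y = 0 := by
      filter_upwards [tendsto_natCast_atTop_atTop.eventually_gt_atTop ‖y‖] with n hn
      apply indicator_of_notMem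
      rwa [mem_compl_iff, not_not, mem_ball_zero_iff]
    exact tendsto_const_nhds.congr' (hev.mono fun n hn => hn.symm)
  have key := tendsto_lintegral_of_dominated_convergence' (μ := volume)
    (F := fun n : ℕ => (Metric.ball (0 : ℝ³) n)ᶜ.indicator h) (f := fun _ => 0) h
    (fun n => hm.indicator measurableSet_ball.compl)
    (fun n => ae_of_all _ fun y => indicator_le_self _ _ y) hfin (ae_of_all _ hpt)
  simpa only [lintegral_indicator measurableSet_ball.compl, lintegral_zero] using key

/-- **Key lemma for part (ii).** For bounded measurable `g` with `∫ |g|²/|y| ≤ K` (centre `0`):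
`ρ⁻² ∫_{B_ρ} |g| → 0`, in the form `∀ ε > 0, ∃ ρ₀, ∀ ρ ≥ ρ₀, ∫_{B_ρ} |g| ≤ ε ρ²`. Proof: choose
`R` with the Hardy tail `∫_{|y| > R} |g|²/|y| ≤ δ²`, `δ (1 + |B_1|) = ε`; on `B_ρ ∖ B_R` use the
weighted AM–GM `|g| ≤ (μ/2)|g|²/|y| + |y|/(2μ)` with `μ = ρ²/δ`, on `B_R` the sup bound.
[folklore] -/
theorem hardy_setLIntegral_ball_le (g : ℝ³ → ℝ³) (K : ℝ≥0) (C : ℝ)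
    (hg : AEStronglyMeasurable g volume) (hC : ∀ x, ‖g x‖ ≤ C)
    (hH : ∫⁻ x, ‖g x‖ₑ ^ 2 / ‖x‖ₑ ≤ K) {ε : ℝ} (hε : 0 < ε) :
    ∃ ρ₀ : ℝ, 0 < ρ₀ ∧ ∀ ρ, ρ₀ ≤ ρ →
      ∫⁻ y in Metric.ball (0 : ℝ³) ρ, ‖g y‖ₑ ≤ ENNReal.ofReal (ε * ρ ^ 2) := by
  set V : ℝ≥0∞ := volume (Metric.ball (0 : ℝ³) 1) with hV
  have hVtop : V ≠ ∞ := measure_ball_lt_top.ne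
  set v : ℝ := V.toReal
  have hv : 0 ≤ v := ENNReal.toReal_nonneg
  have hVv : V = ENNReal.ofReal v := (ENNReal.ofReal_toReal hVtop).symm
  set δ : ℝ := ε / (1 + v) with hδ_def
  have hδ : 0 < δ := by positivity
  have hδε : δ * (1 + v) = ε := by rw [hδ_def]; field_simp
  have hC0 : 0 ≤ C := (norm_nonneg _).trans (hC 0)
  have hball : ∀ {r : ℝ}, 0 < r → volume (Metric.ball (0 : ℝ³) r) = ENNReal.ofReal (r ^ 3 * v) := by
    intro r hr
    rw [Measure.addHaar_ball_of_pos volume 0 hr, finrank_euclideanSpace_fin, ← hV, hVv,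
      ← ENNReal.ofReal_mul (by positivity)]
  -- the Hardy tail
  have hm : AEMeasurable (fun y : ℝ³ => ‖g y‖ₑ ^ 2 / ‖y‖ₑ) volume :=
    (hg.enorm.pow_const 2).div measurable_enorm.aemeasurable
  have htail := tendsto_lintegral_compl_ball_zero hm (hH.trans_lt ENNReal.coe_lt_top).ne
  rw [ENNReal.tendsto_atTop_zero] at htail
  obtain ⟨N, hN⟩ := htail (ENNReal.ofReal (δ ^ 2)) (by simpa using pow_pos hδ 2)
  set R : ℝ := max (N : ℝ) 1
  have hR1 : 1 ≤ R := le_max_right _ _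
  have hRpos : 0 < R := one_pos.trans_le hR1
  have htailR : ∫⁻ y in (Metric.ball (0 : ℝ³) R)ᶜ, ‖g y‖ₑ ^ 2 / ‖y‖ₑ ≤ ENNReal.ofReal (δ ^ 2) :=
    (lintegral_mono_set (compl_subset_compl.2 (Metric.ball_subset_ball (le_max_left _ _)))).trans
      (hN N le_rfl)
  refine ⟨max R (2 * C * R ^ 3 * v / ε + 1), lt_max_of_lt_left hRpos, fun ρ hρ => ?_⟩
  have hRρ : R ≤ ρ := (le_max_left _ _).trans hρ
  have hρpos : 0 < ρ := hRpos.trans_le hRρ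
  have hρ2 : C * R ^ 3 * v ≤ ε / 2 * ρ ^ 2 := by
    have h1 : 2 * C * R ^ 3 * v / ε + 1 ≤ ρ := (le_max_right _ _).trans hρ
    have h2 : 2 * C * R ^ 3 * v / ε ≤ ρ ^ 2 := by nlinarith
    rw [div_le_iff₀ hε] at h2
    linarith
  -- inner ball
  have hin : ∫⁻ y in Metric.ball (0 : ℝ³) R, ‖g y‖ₑ ≤ ENNReal.ofReal (ε / 2 * ρ ^ 2) := by
    calc ∫⁻ y in Metric.ball (0 : ℝ³) R, ‖g y‖ₑ
        ≤ ∫⁻ _ in Metric.ball (0 : ℝ³) R, ENNReal.ofReal C :=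
          lintegral_mono fun y => by rw [← ofReal_norm]; exact ENNReal.ofReal_le_ofReal (hC y)
      _ = ENNReal.ofReal (C * R ^ 3 * v) := by
          rw [setLIntegral_const, hball hRpos, ← ENNReal.ofReal_mul hC0, mul_assoc]
      _ ≤ ENNReal.ofReal (ε / 2 * ρ ^ 2) := ENNReal.ofReal_le_ofReal hρ2
  -- the shell `B_ρ \ B_R`
  have hshell : ∫⁻ y in Metric.ball (0 : ℝ³) ρ \ Metric.ball 0 R, ‖g y‖ₑ ≤
      ENNReal.ofReal (ε / 2 * ρ ^ 2) := by
    set S := Metric.ball (0 : ℝ³) ρ \ Metric.ball 0 R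
    have hS : MeasurableSet S := measurableSet_ball.diff measurableSet_ball
    have hSvol : volume S ≤ ENNReal.ofReal (ρ ^ 3 * v) := hball hρpos ▸ measure_mono sdiff_subset
    set μ' : ℝ := ρ ^ 2 / δ with hμ'_def
    have hμ' : 0 < μ' := by positivity
    calc ∫⁻ y in S, ‖g y‖ₑ
        ≤ ∫⁻ y in S, (ENNReal.ofReal (μ' / 2) * (‖g y‖ₑ ^ 2 / ‖y‖ₑ) +
            ENNReal.ofReal (ρ / (2 * μ'))) := by
          refine setLIntegral_mono' hS fun y hy => ?_
          have hyR : R ≤ ‖y‖ := by simpa using hy.2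
          have hyρ : ‖y‖ < ρ := mem_ball_zero_iff.1 hy.1
          have hy0 : y ≠ 0 := by
            rintro rfl
            rw [norm_zero] at hyR
            linarith
          refine (enorm_le_weighted (g y) hy0 hμ').trans ?_
          gcongr
          rw [← ofReal_norm, ← ENNReal.ofReal_mul (by positivity)]
          refine ENNReal.ofReal_le_ofReal ?_
          rw [div_mul_eq_mul_div, one_mul]
          exact div_le_div_of_nonneg_right hyρ.le (by positivity)
      _ = ENNReal.ofReal (μ' / 2) * (∫⁻ y in S, ‖g y‖ₑ ^ 2 / ‖y‖ₑ) +
            ENNReal.ofReal (ρ / (2 * μ')) * volume S := by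
          rw [lintegral_add_right' _ aemeasurable_const,
            lintegral_const_mul' _ _ ENNReal.ofReal_ne_top, setLIntegral_const]
      _ ≤ ENNReal.ofReal (μ' / 2) * ENNReal.ofReal (δ ^ 2) +
            ENNReal.ofReal (ρ / (2 * μ')) * ENNReal.ofReal (ρ ^ 3 * v) := by
          gcongr
          · exact (lintegral_mono_set (Set.sdiff_subset_compl _ _)).trans htailR
      _ = ENNReal.ofReal (ε / 2 * ρ ^ 2) := by
          rw [← ENNReal.ofReal_mul (by positivity), ← ENNReal.ofReal_mul (by positivity),
            ← ENNReal.ofReal_add (by positivity) (by positivity)]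
          congr 1
          rw [hμ'_def, ← hδε]
          field_simp
  calc ∫⁻ y in Metric.ball (0 : ℝ³) ρ, ‖g y‖ₑ
      ≤ ∫⁻ y in Metric.ball (0 : ℝ³) R ∪ (Metric.ball (0 : ℝ³) ρ \ Metric.ball 0 R), ‖g y‖ₑ :=
        lintegral_mono_set (by rw [Set.union_sdiff_self]; exact subset_union_right)
    _ ≤ (∫⁻ y in Metric.ball (0 : ℝ³) R, ‖g y‖ₑ) +
          ∫⁻ y in Metric.ball (0 : ℝ³) ρ \ Metric.ball 0 R, ‖g y‖ₑ := lintegral_union_le _ _ _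
    _ ≤ ENNReal.ofReal (ε / 2 * ρ ^ 2) + ENNReal.ofReal (ε / 2 * ρ ^ 2) := add_le_add hin hshell
    _ = ENNReal.ofReal (ε * ρ ^ 2) := by
        rw [← ENNReal.ofReal_add (by positivity) (by positivity)]
        congr 1
        ring

/-- **Part (ii) of `stub_hardyLargeScale`.** For bounded measurable `g` with `∫ |g|²/|y| ≤ K`
(centre `0`) and a test field `φ`: `∫ ⟪λ g(λx), φ(x)⟫ dx → 0` as `λ → ∞`. Indeed for `λ > 0`,
`supp φ ⊆ B_{R₁}`, `|φ| ≤ Φ`: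
`|∫ ⟪λ g(λx), φ(x)⟫| ≤ λ Φ ∫_{B_{R₁}} |g(λx)| dx = λ⁻² Φ ∫_{B_{λR₁}} |g|`, which is small by
`hardy_setLIntegral_ball_le`. [folklore] -/
theorem tendsto_integral_inner_rescale_of_hardy (g : ℝ³ → ℝ³) (K : ℝ≥0) (C : ℝ)
    (hg : AEStronglyMeasurable g volume) (hC : ∀ x, ‖g x‖ ≤ C)
    (hH : ∫⁻ x, ‖g x‖ₑ ^ 2 / ‖x‖ₑ ≤ K) (φ : ℝ³ → ℝ³)
    (hφ : Literature.Analysis.FunctionSpaces.IsTestFunctionOn (⊤ : Opens ℝ³) φ) :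
    Tendsto (fun lam : ℝ => ∫ x, ⟪lam • g (lam • x), φ x⟫) atTop (𝓝 0) := by
  obtain ⟨Φ, hΦ⟩ : ∃ Φ, ∀ x, ‖φ x‖ ≤ Φ :=
    hφ.contDiff.continuous.bounded_above_of_compact_support hφ.hasCompactSupport
  obtain ⟨R₀, hR₀⟩ : ∃ R₀, tsupport φ ⊆ Metric.closedBall 0 R₀ :=
    hφ.hasCompactSupport.isCompact.isBounded.subset_closedBall 0
  have hΦ0 : 0 ≤ Φ := (norm_nonneg _).trans (hΦ 0)
  set R₁ : ℝ := max R₀ 0 + 1 with hR₁_def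
  have hR₁ : 0 < R₁ := by positivity
  have hφ0 : ∀ x, R₁ ≤ ‖x‖ → φ x = 0 := by
    intro x hx
    refine image_eq_zero_of_notMem_tsupport fun hmem => ?_
    have h := mem_closedBall_zero_iff.1 (hR₀ hmem)
    have : R₀ < R₁ := (le_max_left _ _).trans_lt (lt_add_one _)
    linarith
  rw [Metric.tendsto_atTop]
  intro ε hε
  obtain ⟨ρ₀, -, hB⟩ := hardy_setLIntegral_ball_le g K C hg hC hH
    (ε := ε / (2 * (Φ * R₁ ^ 2 + 1))) (by positivity)
  refine ⟨max 1 (ρ₀ / R₁), fun lam hlam => ?_⟩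
  have hlam0 : 0 < lam := one_pos.trans_le ((le_max_left _ _).trans hlam)
  have hlamR : ρ₀ ≤ lam * R₁ := by
    rw [← div_le_iff₀ hR₁]
    exact (le_max_right _ _).trans hlam
  rw [dist_zero_right]
  -- pointwise bound of the integrand
  have hpt : ∀ x : ℝ³, ‖⟪lam • g (lam • x), φ x⟫‖ₑ ≤ ENNReal.ofReal (lam * Φ) *
      (Metric.ball (0 : ℝ³) (lam * R₁)).indicator (fun y => ‖g y‖ₑ) (lam • x) := by
    intro x
    by_cases hx : ‖x‖ < R₁
    · have hmem : lam • x ∈ Metric.ball (0 : ℝ³) (lam * R₁) := by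
        rw [mem_ball_zero_iff, norm_smul, Real.norm_eq_abs, abs_of_pos hlam0]
        exact mul_lt_mul_of_pos_left hx hlam0
      rw [indicator_of_mem hmem, ← ofReal_norm, ← ofReal_norm,
        ← ENNReal.ofReal_mul (by positivity)]
      refine ENNReal.ofReal_le_ofReal ?_
      calc ‖⟪lam • g (lam • x), φ x⟫‖ ≤ ‖lam • g (lam • x)‖ * ‖φ x‖ := norm_inner_le_norm _ _
        _ = lam * ‖g (lam • x)‖ * ‖φ x‖ := by rw [norm_smul, Real.norm_eq_abs, abs_of_pos hlam0]
        _ ≤ lam * ‖g (lam • x)‖ * Φ := by gcongr; exact hΦ x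
        _ = lam * Φ * ‖g (lam • x)‖ := by ring
    · rw [hφ0 x (not_lt.1 hx), inner_zero_right, enorm_zero]
      exact zero_le
  have hI : ‖∫ x, ⟪lam • g (lam • x), φ x⟫‖ₑ ≤ ENNReal.ofReal (ε / 2) := by
    calc ‖∫ x, ⟪lam • g (lam • x), φ x⟫‖ₑ
        ≤ ∫⁻ x, ‖⟪lam • g (lam • x), φ x⟫‖ₑ := enorm_integral_le_lintegral_enorm _
      _ ≤ ∫⁻ x, ENNReal.ofReal (lam * Φ) *
            (Metric.ball (0 : ℝ³) (lam * R₁)).indicator (fun y => ‖g y‖ₑ) (lam • x) :=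
          lintegral_mono hpt
      _ = ENNReal.ofReal (lam * Φ) * (ENNReal.ofReal ((lam ^ 3)⁻¹) *
            ∫⁻ y in Metric.ball (0 : ℝ³) (lam * R₁), ‖g y‖ₑ) := by
          rw [lintegral_const_mul' _ _ ENNReal.ofReal_ne_top,
            Literature.Analysis.FluidPDE.RieszKernel.lintegral_comp_smul _ hlam0,
            lintegral_indicator measurableSet_ball]
      _ ≤ ENNReal.ofReal (lam * Φ) * (ENNReal.ofReal ((lam ^ 3)⁻¹) *
            ENNReal.ofReal (ε / (2 * (Φ * R₁ ^ 2 + 1)) * (lam * R₁) ^ 2)) := by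
          gcongr
          exact hB _ hlamR
      _ = ENNReal.ofReal (lam * Φ * ((lam ^ 3)⁻¹ *
            (ε / (2 * (Φ * R₁ ^ 2 + 1)) * (lam * R₁) ^ 2))) := by
          rw [← ENNReal.ofReal_mul (by positivity), ← ENNReal.ofReal_mul (by positivity)]
      _ ≤ ENNReal.ofReal (ε / 2) := by
          refine ENNReal.ofReal_le_ofReal ?_
          have h1 : lam * Φ * ((lam ^ 3)⁻¹ * (ε / (2 * (Φ * R₁ ^ 2 + 1)) * (lam * R₁) ^ 2)) =
              Φ * R₁ ^ 2 / (Φ * R₁ ^ 2 + 1) * (ε / 2) := by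
            field_simp
          have h2 : Φ * R₁ ^ 2 / (Φ * R₁ ^ 2 + 1) ≤ 1 :=
            (div_le_one (by positivity)).2 (by linarith)
          rw [h1]
          calc Φ * R₁ ^ 2 / (Φ * R₁ ^ 2 + 1) * (ε / 2) ≤ 1 * (ε / 2) := by gcongr
            _ = ε / 2 := one_mul _
  rw [← ofReal_norm, ENNReal.ofReal_le_ofReal_iff (by positivity)] at hI
  linarith

/-- **Stub `stub_hardyLargeScale` (Hardy ⇒ `𝔹`).** A bounded measurable slice `g : ℝ³ → ℝ³` whose
Hardy integrals `∫ |g|²/|x − x₀|` are `≤ K` about every centre satisfies (i) the heat-kernel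
`Ḃ^{-1}_{∞,∞}` bound `√σ ‖e^{σΔ}g‖_∞ ≤ A` (`sqrt_mul_norm_heatExtension_le_of_hardy`) and (ii) its
Navier–Stokes rescalings `λ g(λ·)` tend to `0` in `𝒟'` (`tendsto_integral_inner_rescale_of_hardy`),
i.e. `g` lies in Albritton–Barker's class `𝔹` (arXiv:1811.00502, §4). [folklore] -/
theorem stub_hardyLargeScale :
    ∀ (g : EuclideanSpace ℝ (Fin 3) → EuclideanSpace ℝ (Fin 3)) (K : ℝ≥0) (C : ℝ),
      AEStronglyMeasurable g volume →
      (∀ x, ‖g x‖ ≤ C) →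
      (∀ x₀ : EuclideanSpace ℝ (Fin 3), ∫⁻ x, ‖g x‖ₑ ^ 2 / ‖x - x₀‖ₑ ≤ K) →
      (∃ A : ℝ, ∀ σ : ℝ, 0 < σ → ∀ x,
        Real.sqrt σ * ‖Literature.Analysis.UnboundedOperators.heatExtension g σ x‖ ≤ A) ∧
      (∀ φ : EuclideanSpace ℝ (Fin 3) → EuclideanSpace ℝ (Fin 3),
        Literature.Analysis.FunctionSpaces.IsTestFunctionOn
          (⊤ : Opens (EuclideanSpace ℝ (Fin 3))) φ →
        Tendsto (fun lam : ℝ => ∫ x, ⟪lam • g (lam • x), φ x⟫) atTop (𝓝 0)) := by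
  intro g K C hg hC hH
  refine ⟨⟨(4 * Real.pi) ^ (-(3 : ℝ) / 2) * 2 ^ ((3 : ℝ) / 2) + K / 2, fun σ hσ x =>
    sqrt_mul_norm_heatExtension_le_of_hardy g K hH hσ x⟩, fun φ hφ => ?_⟩
  have hH0 : ∫⁻ x, ‖g x‖ₑ ^ 2 / ‖x‖ₑ ≤ K := by simpa using hH 0
  exact tendsto_integral_inner_rescale_of_hardy g K C hg hC hH0 φ hφ

end Summit.NavierStokesRegularity.NavierStokesRegularity.Theorems
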